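import Summits.BirchSwinnertonDyer.Rank1Residual.Supersingular.TamParityChi8Link
import Literature.NumberTheory.EllipticCurves.ComplexMultiplicationLocalFactorsAux
import HarnessLib

/-!
# `a₂(E) ∈ {0, 2, −2}` READ OFF THE MINIMAL MODEL at a good supersingular prime `2`:
# `a₂(E) = 0 ⟺ a₂ + a₄ even`, `a₂(E) = −2 ⟺ a₂ + a₄ odd ∧ a₆ even`, `a₂(E) = 2 ⟺ a₂ + a₄ odd ∧ a₆ odd`
# (cell `b2b-bsdres`, O1 sub-cell `p = 2`; cc-typer-4 GEN 7, typer item (28a) of o1 lead ruling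
# R-G26.2 / C192 (b))

HONEST FRAMING (run/shared/lean/b2b/bsd-rank1-residual/, verbatim in every file): the goal of the
cell is to DELETE the COMBINATION-SHAPED residual classes of the Birch–Swinnerton-Dyer formula for
ALL analytic-rank `≤ 1` elliptic curves over `ℚ` — "full BSD formula for every rank `≤ 1` curve in
class `C`" assembled STRICTLY from published theorems — so that the rank-`≤ 1` remainder becomes
exactly the CONSTRUCTION-SHAPED classes, which are TYPED (missing-input `Prop`s), NOT attempted.
This is not "finishing BSD". THEOREMS ONLY (a finite point count over `𝔽₂` and its reading on the
tree's `integralModelInt W` / `reductionPointCount W 2` / `frobeniusTrace W 2`); every hypothesis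
explicit; nothing about any particular curve is asserted; nothing booked; no label moves.

WHAT. For a globally minimal `W / ℚ` with GOOD SUPERSINGULAR reduction at `2`
(`W.HasGoodReductionAtPrime 2`, `2 ∣ W.frobeniusTrace 2`) the minimal model has `a₁` even and `a₃`
odd (`even_a₁_and_odd_a₃_of_goodSS_two`, `TamParityChi8Link.lean` p290592), so its reduction is the
normal form `ȳ² + ȳ = x̄³ + ā₂x̄² + ā₄x̄ + ā₆` over `𝔽₂`, whose point count is
`#Ẽ(𝔽₂) = 1 + 2·[ā₆ = 0] + 2·[ā₂ + ā₄ + ā₆ = 1] ∈ {3, 5, 1}` (§1, kernel-decided over the eight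
normal forms). Hence (§2) `reductionPointCount W 2 = 3 / 5 / 1` and
`a₂(E) = frobeniusTrace W 2 = 3 − #Ẽ(𝔽₂) = 0 / −2 / 2` according as `a₂ + a₄` is even / `a₂ + a₄`
is odd and `a₆` even / `a₂ + a₄` and `a₆` are odd:

* `frobeniusTrace_two_eq_zero_iff_even_a₂_add_a₄` — THE (28a) STATEMENT (o1 refuter v14 §95 shape);
* `frobeniusTrace_two_eq_neg_two_iff`, `frobeniusTrace_two_eq_two_iff` — the sign pair;
* `frobeniusTrace_two_eq_zero_or` — `a₂(E) ∈ {0, 2, −2}` (the Hasse bound at `2`, ss case).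

This is the POINT-COUNT half of the cell's supersingular-`2` law of record (o1 `PLAN.md` C179 D35
(s6), lens-2 GEN 13 THEOREM S, lens-1 GEN 11 (G11.1) (S8); refuter v14 §95 PASS; lead C192 (b)):
"`loc₂(c₀) = 0 ⟺ a₂(E) = 0 ⟺ a₂ + a₄ even` on the minimal model". The Kummer / local-condition
half (`loc₂(c₀) ∈ W₂` and `loc₂(c₀) = 0 ⟺ a₂(E) = 0`) is NOT part of (28a) and is not typed here.

CREDIT. §1 is the tree-language form (`Fintype.card` of the solution subtype, as in the tree's
`WeierstrassCurve.natCard_point_eq_one_add_card`) of lens-1 GEN 11's kernel-checked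
`LensOneG11.affineCount_eq` / `trace_eq_zero_iff` / `trace_mem`
(`HOME/b2b-bsdres-o1-idea-1-g11/lean/G11_SS2Bits.lean`, sha16 `66971e4e6125a93d`; lead C189 (a):
"a SOURCE the typer may port with credit"); the reduction of `reductionPointCount W 2` to the eight
normal forms (§2) is this file's.

References: J. H. Silverman, AEC (GTM 106) V.2 (`a_p = p + 1 − #Ẽ(𝔽_p)`), VII.5 Prop. 5.1,
App. A Prop. 1.1 (c) (normal forms in characteristic 2) [SilvermanAEC2009]; folder record
`HOME/class-closure/O1/TYPING.md` §10.
-/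

set_option autoImplicit false

namespace Summit.BirchSwinnertonDyer.Rank1Residual.Supersingular

open WeierstrassCurve

/-! ## §1. Over `𝔽₂`: the point count of the supersingular normal form -/

/-- **`#Ẽ(𝔽₂)` on the normal form.** For `E = ⟨a₁, a₂, a₃, a₄, a₆⟩ / 𝔽₂` with `a₁ = 0`, `a₃ = 1`
(then `Δ = 1`): `#E(𝔽₂) = 1 + #{(x, y) : y² + y = x³ + a₂x² + a₄x + a₆} = 3` if `a₂ + a₄ = 0`,
`= 5` if `a₂ + a₄ = 1 ∧ a₆ = 0`, `= 1` if `a₂ + a₄ = 1 ∧ a₆ = 1` (`y² + y = c` has two solutions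
iff `c = 0`; columns `x = 0`: `c = a₆`, `x = 1`: `c = 1 + a₂ + a₄ + a₆`). Kernel-decided over the
eight normal forms (lens-1 G11 `affineCount_eq`). [folklore] -/
theorem natCard_point_F2_of_a₁_eq_zero_of_a₃_eq_one (E : WeierstrassCurve (ZMod 2))
    (h₁ : E.a₁ = 0) (h₃ : E.a₃ = 1) :
    Nat.card E.toAffine.Point =
      if E.a₂ + E.a₄ = 0 then 3 else if E.a₆ = 0 then 5 else 1 := by
  have hΔ : E.Δ ≠ 0 := by
    have key : ∀ a₁ a₂ a₃ a₄ a₆ : ZMod 2, a₁ = 0 → a₃ = 1 →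
        (⟨a₁, a₂, a₃, a₄, a₆⟩ : WeierstrassCurve (ZMod 2)).Δ ≠ 0 := by
      simp only [WeierstrassCurve.Δ, WeierstrassCurve.b₂, WeierstrassCurve.b₄, WeierstrassCurve.b₆,
        WeierstrassCurve.b₈]
      decide
    obtain ⟨a₁, a₂, a₃, a₄, a₆⟩ := E
    exact key a₁ a₂ a₃ a₄ a₆ h₁ h₃
  rw [natCard_point_eq_one_add_card E hΔ]
  have key : ∀ a₁ a₂ a₃ a₄ a₆ : ZMod 2, a₁ = 0 → a₃ = 1 →
      1 + Fintype.card {xy : ZMod 2 × ZMod 2 //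
          xy.2 ^ 2 + a₁ * xy.1 * xy.2 + a₃ * xy.2 = xy.1 ^ 3 + a₂ * xy.1 ^ 2 + a₄ * xy.1 + a₆} =
        if a₂ + a₄ = 0 then 3 else if a₆ = 0 then 5 else 1 := by
    decide
  obtain ⟨a₁, a₂, a₃, a₄, a₆⟩ := E
  exact key a₁ a₂ a₃ a₄ a₆ h₁ h₃

/-! ## §2. The globally minimal model of a curve with good supersingular reduction at `2` -/

section Minimal

variable (W : WeierstrassCurve ℚ) [W.IsGloballyMinimal]

/-- `(2 : ZMod 2) = 0`. [folklore] -/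
private theorem two_eq_zero_zmod_two : (2 : ZMod 2) = 0 := by decide

/-- Parity of an integer read in `ZMod 2`. [folklore] -/
theorem intCast_zmod_two_eq_zero_iff_even (n : ℤ) : ((n : ℤ) : ZMod 2) = 0 ↔ Even n := by
  rw [ZMod.intCast_zmod_eq_zero_iff_dvd, even_iff_two_dvd]
  norm_num

/-- **The point count mod `2` of the minimal model at a good supersingular `2`**:
`#Ẽ(𝔽₂) = 3` if `a₂ + a₄` is even, `= 5` if `a₂ + a₄` is odd and `a₆` even, `= 1` if `a₂ + a₄`
and `a₆` are odd (`a₁` even, `a₃` odd by `even_a₁_and_odd_a₃_of_goodSS_two`, then §1).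
[folklore] -/
theorem reductionPointCount_two_eq_of_goodSS (hgood : W.HasGoodReductionAtPrime 2)
    (hss : (2 : ℤ) ∣ W.frobeniusTrace 2) :
    reductionPointCount W 2 =
      if Even ((integralModelInt W).a₂ + (integralModelInt W).a₄) then 3
      else if Even (integralModelInt W).a₆ then 5 else 1 := by
  obtain ⟨h₁, h₃⟩ := even_a₁_and_odd_a₃_of_goodSS_two W hgood hss
  set F : WeierstrassCurve (ZMod 2) := (integralModelInt W).map (Int.castRingHom (ZMod 2)) with hF
  have hF1 : F.a₁ = 0 := by
    rw [hF, WeierstrassCurve.map_a₁, eq_intCast, intCast_zmod_two_eq_zero_iff_even]; exact h₁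
  have hF3 : F.a₃ = 1 := by
    obtain ⟨k, hk⟩ := h₃
    rw [hF, WeierstrassCurve.map_a₃, eq_intCast, hk]
    push_cast
    rw [two_eq_zero_zmod_two, zero_mul, zero_add]
  have h24 : F.a₂ + F.a₄ = 0 ↔ Even ((integralModelInt W).a₂ + (integralModelInt W).a₄) := by
    rw [hF, WeierstrassCurve.map_a₂, WeierstrassCurve.map_a₄, eq_intCast, eq_intCast, ← Int.cast_add,
      intCast_zmod_two_eq_zero_iff_even]
  have h6 : F.a₆ = 0 ↔ Even (integralModelInt W).a₆ := by
    rw [hF, WeierstrassCurve.map_a₆, eq_intCast, intCast_zmod_two_eq_zero_iff_even]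
  unfold WeierstrassCurve.reductionPointCount
  rw [← hF, natCard_point_F2_of_a₁_eq_zero_of_a₃_eq_one F hF1 hF3]
  by_cases h : Even ((integralModelInt W).a₂ + (integralModelInt W).a₄)
  · rw [if_pos (h24.mpr h), if_pos h]
  · rw [if_neg (fun h' ↦ h (h24.mp h')), if_neg h]
    by_cases h' : Even (integralModelInt W).a₆
    · rw [if_pos (h6.mpr h'), if_pos h']
    · rw [if_neg (fun h'' ↦ h' (h6.mp h'')), if_neg h']

/-- **(28a) `a₂(E) = 0 ⟺ a₂ + a₄ is even`** on the globally minimal model of a curve with good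
supersingular reduction at `2` (the point-count half of the cell's supersingular-`2` law; o1 refuter
v14 §95 shape). [folklore] -/
theorem frobeniusTrace_two_eq_zero_iff_even_a₂_add_a₄ (hgood : W.HasGoodReductionAtPrime 2)
    (hss : (2 : ℤ) ∣ W.frobeniusTrace 2) :
    W.frobeniusTrace 2 = 0 ↔ Even ((integralModelInt W).a₂ + (integralModelInt W).a₄) := by
  have h := reductionPointCount_two_eq_of_goodSS W hgood hss
  unfold WeierstrassCurve.frobeniusTrace
  by_cases h24 : Even ((integralModelInt W).a₂ + (integralModelInt W).a₄)
  · rw [if_pos h24] at h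
    rw [h]; simp [h24]
  · rw [if_neg h24] at h
    by_cases h6 : Even (integralModelInt W).a₆
    · rw [if_pos h6] at h
      rw [h]; simp [h24]
    · rw [if_neg h6] at h
      rw [h]; simp [h24]

/-- **Sign pair, `−2`: `a₂(E) = −2 ⟺ a₂ + a₄ odd ∧ a₆ even`** (`#Ẽ(𝔽₂) = 5`). [folklore] -/
theorem frobeniusTrace_two_eq_neg_two_iff (hgood : W.HasGoodReductionAtPrime 2)
    (hss : (2 : ℤ) ∣ W.frobeniusTrace 2) :
    W.frobeniusTrace 2 = -2 ↔
      Odd ((integralModelInt W).a₂ + (integralModelInt W).a₄) ∧ Even (integralModelInt W).a₆ := by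
  have h := reductionPointCount_two_eq_of_goodSS W hgood hss
  unfold WeierstrassCurve.frobeniusTrace
  rw [← Int.not_even_iff_odd]
  by_cases h24 : Even ((integralModelInt W).a₂ + (integralModelInt W).a₄)
  · rw [if_pos h24] at h
    rw [h]; simp [h24]
  · rw [if_neg h24] at h
    by_cases h6 : Even (integralModelInt W).a₆
    · rw [if_pos h6] at h
      rw [h]; simp [h24, h6]
    · rw [if_neg h6] at h
      rw [h]; simp [h6]

/-- **Sign pair, `+2`: `a₂(E) = 2 ⟺ a₂ + a₄ odd ∧ a₆ odd`** (`#Ẽ(𝔽₂) = 1`). [folklore] -/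
theorem frobeniusTrace_two_eq_two_iff (hgood : W.HasGoodReductionAtPrime 2)
    (hss : (2 : ℤ) ∣ W.frobeniusTrace 2) :
    W.frobeniusTrace 2 = 2 ↔
      Odd ((integralModelInt W).a₂ + (integralModelInt W).a₄) ∧ Odd (integralModelInt W).a₆ := by
  have h := reductionPointCount_two_eq_of_goodSS W hgood hss
  unfold WeierstrassCurve.frobeniusTrace
  rw [← Int.not_even_iff_odd, ← Int.not_even_iff_odd]
  by_cases h24 : Even ((integralModelInt W).a₂ + (integralModelInt W).a₄)
  · rw [if_pos h24] at h
    rw [h]; simp [h24]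
  · rw [if_neg h24] at h
    by_cases h6 : Even (integralModelInt W).a₆
    · rw [if_pos h6] at h
      rw [h]; simp [h6]
    · rw [if_neg h6] at h
      rw [h]; simp [h24, h6]

/-- **`a₂(E) ∈ {0, 2, −2}` at a good supersingular `2`** (Hasse at `2` in the supersingular case,
here by the point count). [folklore] -/
theorem frobeniusTrace_two_eq_zero_or (hgood : W.HasGoodReductionAtPrime 2)
    (hss : (2 : ℤ) ∣ W.frobeniusTrace 2) :
    W.frobeniusTrace 2 = 0 ∨ W.frobeniusTrace 2 = 2 ∨ W.frobeniusTrace 2 = -2 := by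
  have h := reductionPointCount_two_eq_of_goodSS W hgood hss
  unfold WeierstrassCurve.frobeniusTrace
  split_ifs at h <;> (rw [h]; norm_num)

/-- **The two supersingular shapes by a parity**: `a₂(E) = 0` if `a₂ + a₄` is even, `a₂(E) = ±2`
if it is odd. [folklore] -/
theorem frobeniusTrace_two_eq_two_or_eq_neg_two_iff_odd (hgood : W.HasGoodReductionAtPrime 2)
    (hss : (2 : ℤ) ∣ W.frobeniusTrace 2) :
    (W.frobeniusTrace 2 = 2 ∨ W.frobeniusTrace 2 = -2) ↔
      Odd ((integralModelInt W).a₂ + (integralModelInt W).a₄) := by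
  rw [frobeniusTrace_two_eq_two_iff W hgood hss, frobeniusTrace_two_eq_neg_two_iff W hgood hss]
  constructor
  · rintro (⟨h, -⟩ | ⟨h, -⟩) <;> exact h
  · intro h
    rcases Int.even_or_odd (integralModelInt W).a₆ with h6 | h6
    · exact Or.inr ⟨h, h6⟩
    · exact Or.inl ⟨h, h6⟩

end Minimal

end Summit.BirchSwinnertonDyer.Rank1Residual.Supersingular
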